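import Mathlib
import Summits.Ventures.PercRepro2.Tail2DBlockCalc
import Summits.Ventures.PercRepro2.Tail2DHarrisSP
import Summits.Ventures.PercRepro2.Tail2DFlowOneBlocks
import Summits.Ventures.PercRepro2.Tail2DFlowOneStep01
import Summits.Ventures.PercRepro2.Tail2DParFin
import Summits.Ventures.PercRepro2.Tail2DParFinFlip

/-!
# (SD) at the diagonal positions `(u, u−1)` on parallel compositions of `k` flow-one factors, for every `k`
(seat mine-b, cell pub-perc-repro2; conjectures/MINE-B.md §43)

At a diagonal position the source `E(u,u−1)` and the target `E(u−1,u)` have the same size (the colour swap) and,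
word by word, the same T-class masses: a word with `m` crossing letters contributes `Unif(block)` with the same
weight on both sides when its number of `B`s lies in `[u, m−u]` (it is then in both tails and STAYS), while the
source words with exactly `u−1` `B`s (and `m−u+1` `R`s) are spread UNIFORMLY over the target words with `m−u+1`
`B`s (and `u−1` `R`s) above them — turn a uniformly random set of `m−2u+2` of the reds blue.  Both sides of the
spreading are counted by the same binomial coefficient `C(m−u+1, m−2u+2) = C(m−u+1, u−1)`, and every move is a
product coupling `R ≼ B` on the flipped factors (`blockOf_dom`).  Hence `sdomZ_parFin_diag`: (SD) at every
`(u, u−1)`, `u ≥ 1`, on `X₀ ∥ … ∥ X_{k−1}` for any `k` flow-one factors — the positions of the family whose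
Hall / monotone-relay form (an injection `{r ≥ u, b = u−1} → {r = u−1, b ≥ u}`) follows from (SD) and the count
equality.
-/

namespace Summit.Ventures.PercRepro2.Tail2D

open V2Closure Finset

section Diag

variable (k : ℕ) (X : Fin k → V2Closure.SP) (u : ℕ)

/-- the word is in the source tail `E(u, u−1)` -/
abbrev srcW (w : Fin k → Ltr) : Prop := u ≤ nR k w ∧ u - 1 ≤ nB k w
/-- the word is in the target tail `E(u−1, u)` -/
abbrev tgtW (w : Fin k → Ltr) : Prop := u - 1 ≤ nR k w ∧ u ≤ nB k w
/-- an identity index: `J = ∅` and the word is in both tails -/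
abbrev isId (w : Fin k → Ltr) (J : Finset (Fin k)) : Prop := J = ∅ ∧ srcW k u w ∧ tgtW k u w
/-- a spreading index: the word has exactly `u−1` blues, `J` is a set of `nR − nB` of its reds -/
abbrev isSp (w : Fin k → Ltr) (J : Finset (Fin k)) : Prop :=
  srcW k u w ∧ nB k w = u - 1 ∧ J ⊆ redSet k w ∧ J.card = nR k w - nB k w

/-- the source block of an index -/
def diagP (w : Fin k → Ltr) (J : Finset (Fin k)) : Finset (parFin k X).Conf :=
  if isId k u w J ∨ isSp k u w J then blockOf k X w else ∅

/-- the target block of an index -/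
def diagQ (w : Fin k → Ltr) (J : Finset (Fin k)) : Finset (parFin k X).Conf :=
  if isId k u w J then blockOf k X w else if isSp k u w J then blockOf k X (flipSet k w J) else ∅

/-- the weight of an index -/
noncomputable def diagW (w : Fin k → Ltr) (J : Finset (Fin k)) : ℚ :=
  if isId k u w J then ((blockOf k X w).card : ℚ) / tailCount (parFin k X) u (u - 1)
  else if isSp k u w J then
    ((blockOf k X w).card : ℚ) / (tailCount (parFin k X) u (u - 1) * (nR k w).choose (nR k w - nB k w))
  else 0

/-- the uniform density of the empty block vanishes -/
theorem unifDens_empty (s : V2Closure.SP) (z : s.Conf) : unifDens s ∅ z = 0 := by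
  simp [unifDens]

/-- the block of a flip has the size of the block -/
theorem card_blockOf_flipSet (w : Fin k → Ltr) (J : Finset (Fin k)) (hJ : J ⊆ redSet k w) :
    (blockOf k X (flipSet k w J)).card = (blockOf k X w).card := by
  rw [card_blockOf, card_blockOf]
  refine Finset.prod_congr rfl (fun i _ => ?_)
  rcases flipSet_dom_cond k w J hJ i with h | ⟨h1, h2⟩
  · rw [h]
  · rw [h1, h2]
    exact (card_letterSet_R_eq_B (X i)).symm

/-- the weights are non-negative -/
theorem diagW_nonneg (w : Fin k → Ltr) (J : Finset (Fin k)) : 0 ≤ diagW k X u w J := by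
  unfold diagW
  split_ifs <;> positivity

/-- every index is a product coupling -/
theorem diagP_dom (w : Fin k → Ltr) (J : Finset (Fin k)) :
    BlockDom (parFin k X) (diagP k X u w J) (diagQ k X u w J) := by
  unfold diagP diagQ
  by_cases h1 : isId k u w J
  · rw [if_pos (Or.inl h1), if_pos h1]
    exact blockDom_refl _ _
  · by_cases h2 : isSp k u w J
    · rw [if_pos (Or.inr h2), if_neg h1, if_pos h2]
      exact blockOf_dom k X w _ (flipSet_dom_cond k w J h2.2.2.1)
    · rw [if_neg (fun h => h.elim h1 h2), if_neg h1, if_neg h2]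
      exact blockDom_refl _ _

/-- a target block is non-empty when its source block is -/
theorem diagQ_nonempty (w : Fin k → Ltr) (J : Finset (Fin k)) (_ : 0 < diagW k X u w J)
    (hP : (diagP k X u w J).Nonempty) : (diagQ k X u w J).Nonempty := by
  unfold diagP at hP
  unfold diagQ
  by_cases h1 : isId k u w J
  · rw [if_pos (Or.inl h1)] at hP
    rw [if_pos h1]; exact hP
  · by_cases h2 : isSp k u w J
    · rw [if_pos (Or.inr h2)] at hP
      rw [if_neg h1, if_pos h2]
      apply Finset.card_pos.1
      rw [card_blockOf_flipSet k X w J h2.2.2.1]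
      exact Finset.card_pos.2 hP
    · rw [if_neg (fun h => h.elim h1 h2)] at hP
      exact absurd hP (Finset.not_nonempty_empty)

/-- the density of a source block at a configuration -/
theorem unifDens_diagP (hX : ∀ i, FlowOne (X i)) (w : Fin k → Ltr) (J : Finset (Fin k)) (z : (parFin k X).Conf) :
    unifDens (parFin k X) (diagP k X u w J) z
      = if (isId k u w J ∨ isSp k u w J) ∧ wordOf k X z = w then ((blockOf k X w).card : ℚ)⁻¹ else 0 := by
  unfold diagP
  by_cases h : isId k u w J ∨ isSp k u w J
  · rw [if_pos h, unifDens_blockOf k X hX]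
    by_cases h' : wordOf k X z = w
    · rw [if_pos h', if_pos ⟨h, h'⟩]
    · rw [if_neg h', if_neg (fun hh => h' hh.2)]
  · rw [if_neg h, unifDens_empty, if_neg (fun hh => h hh.1)]

/-- the source coverage of the diagonal certificate -/
theorem diag_src_cov (hX : ∀ i, FlowOne (X i)) (hu : 1 ≤ u) (z : (parFin k X).Conf) :
    ∑ p : (Fin k → Ltr) × Finset (Fin k), diagW k X u p.1 p.2 * unifDens (parFin k X) (diagP k X u p.1 p.2) z
      = unifDens (parFin k X) (tailSet (parFin k X) u (u - 1)) z := by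
  rw [Fintype.sum_prod_type]
  simp only [unifDens_diagP k X u hX]
  rw [Finset.sum_eq_single (wordOf k X z)]
  · -- the inner sum over `J`
    have hE : unifDens (parFin k X) (tailSet (parFin k X) u (u - 1)) z
        = if srcW k u (wordOf k X z) then (tailCount (parFin k X) u (u - 1) : ℚ)⁻¹ else 0 := by
      unfold unifDens
      rw [tailCount_eq_card]
      by_cases h : z ∈ tailSet (parFin k X) u (u - 1)
      · rw [if_pos h, if_pos ((mem_tailSet_parFin k X hX u (u - 1) z).1 h)]
      · rw [if_neg h, if_neg (fun hh => h ((mem_tailSet_parFin k X hX u (u - 1) z).2 hh))]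
    rw [hE]
    set w0 := wordOf k X z with hw0
    have hpos : (0 : ℚ) < (blockOf k X w0).card := by exact_mod_cast card_blockOf_wordOf_pos k X hX z
    by_cases hs : srcW k u w0
    · rw [if_pos hs]
      by_cases hb : u ≤ nB k w0
      · -- an identity word
        have ht : tgtW k u w0 := ⟨le_trans (Nat.sub_le u 1) hs.1, hb⟩
        have hnsp : ∀ J, ¬ isSp k u w0 J := fun J hJ => by have := hJ.2.1; omega
        rw [Finset.sum_eq_single ∅]
        · have hid : isId k u w0 ∅ := ⟨rfl, hs, ht⟩
          rw [if_pos ⟨Or.inl hid, rfl⟩]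
          unfold diagW
          rw [if_pos hid]
          field_simp
        · intro J _ hJ
          have hnid : ¬ isId k u w0 J := fun h => hJ h.1
          rw [if_neg (fun h => h.1.elim hnid (hnsp J)), mul_zero]
        · intro h; exact absurd (Finset.mem_univ _) h
      · -- a spreading word: exactly `u − 1` blues
        have hb' : nB k w0 = u - 1 := by have := hs.2; omega
        have hnid : ∀ J, ¬ isId k u w0 J := fun J hJ => hb hJ.2.2.2
        have hd : nR k w0 - nB k w0 ≤ (redSet k w0).card := by
          rw [← nR_eq_card_redSet]; exact Nat.sub_le _ _
        have hC : (0 : ℚ) < ((nR k w0).choose (nR k w0 - nB k w0) : ℕ) := by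
          exact_mod_cast Nat.choose_pos (Nat.sub_le _ _)
        have hEpos : (0 : ℚ) < tailCount (parFin k X) u (u - 1) := by
          have : 0 < tailCount (parFin k X) u (u - 1) := by
            rw [tailCount_eq_card]
            exact Finset.card_pos.2 ⟨z, (mem_tailSet_parFin k X hX u (u - 1) z).2 hs⟩
          exact_mod_cast this
        have hterm : ∀ J : Finset (Fin k),
            diagW k X u w0 J * (if (isId k u w0 J ∨ isSp k u w0 J) ∧ w0 = w0
              then ((blockOf k X w0).card : ℚ)⁻¹ else 0)
            = if J ∈ (redSet k w0).powersetCard (nR k w0 - nB k w0)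
              then ((tailCount (parFin k X) u (u - 1) : ℚ)
                * ((nR k w0).choose (nR k w0 - nB k w0) : ℕ))⁻¹ else 0 := by
          intro J
          by_cases hJ : J ∈ (redSet k w0).powersetCard (nR k w0 - nB k w0)
          · rw [Finset.mem_powersetCard] at hJ
            have hsp : isSp k u w0 J := ⟨hs, hb', hJ.1, hJ.2⟩
            rw [if_pos ⟨Or.inr hsp, rfl⟩, if_pos (Finset.mem_powersetCard.2 hJ)]
            unfold diagW
            rw [if_neg (hnid J), if_pos hsp]
            field_simp
          · have hnsp : ¬ isSp k u w0 J := fun h => hJ (Finset.mem_powersetCard.2 ⟨h.2.2.1, h.2.2.2⟩)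
            rw [if_neg (fun h => h.1.elim (hnid J) hnsp), mul_zero, if_neg hJ]
        rw [Finset.sum_congr rfl (fun J _ => hterm J), Finset.sum_ite_mem, Finset.univ_inter, Finset.sum_const,
          Finset.card_powersetCard, ← nR_eq_card_redSet, nsmul_eq_mul]
        field_simp
    · rw [if_neg hs]
      apply Finset.sum_eq_zero
      intro J _
      have h0 : diagW k X u w0 J = 0 := by
        unfold diagW
        rw [if_neg (fun h => hs h.2.1), if_neg (fun h => hs h.1)]
      rw [h0, zero_mul]
  · intro w _ hw
    apply Finset.sum_eq_zero
    intro J _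
    rw [if_neg (fun h => hw h.2.symm), mul_zero]
  · intro h; exact absurd (Finset.mem_univ _) h

/-- the density of a target block at a configuration -/
theorem unifDens_diagQ (hX : ∀ i, FlowOne (X i)) (w : Fin k → Ltr) (J : Finset (Fin k)) (z : (parFin k X).Conf) :
    unifDens (parFin k X) (diagQ k X u w J) z
      = if isId k u w J then (if wordOf k X z = w then ((blockOf k X w).card : ℚ)⁻¹ else 0)
        else if isSp k u w J then
          (if wordOf k X z = flipSet k w J then ((blockOf k X (flipSet k w J)).card : ℚ)⁻¹ else 0)
        else 0 := by
  unfold diagQ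
  by_cases h1 : isId k u w J
  · rw [if_pos h1, if_pos h1, unifDens_blockOf k X hX]
  · rw [if_neg h1, if_neg h1]
    by_cases h2 : isSp k u w J
    · rw [if_pos h2, if_pos h2, unifDens_blockOf k X hX]
    · rw [if_neg h2, if_neg h2, unifDens_empty]

/-- the target coverage of the diagonal certificate -/
theorem diag_tgt_cov (hX : ∀ i, FlowOne (X i)) (hu : 1 ≤ u) (z : (parFin k X).Conf) :
    ∑ p : (Fin k → Ltr) × Finset (Fin k), diagW k X u p.1 p.2 * unifDens (parFin k X) (diagQ k X u p.1 p.2) z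
      = unifDens (parFin k X) (tailSet (parFin k X) (u - 1) u) z := by
  set w1 := wordOf k X z with hw1
  have hpos : (0 : ℚ) < (blockOf k X w1).card := by exact_mod_cast card_blockOf_wordOf_pos k X hX z
  set E : ℚ := (tailCount (parFin k X) u (u - 1) : ℚ) with hE
  -- the right-hand side
  have hR : unifDens (parFin k X) (tailSet (parFin k X) (u - 1) u) z
      = if tgtW k u w1 then E⁻¹ else 0 := by
    unfold unifDens
    rw [hE, tailCount_symm, tailCount_eq_card]
    by_cases h : z ∈ tailSet (parFin k X) (u - 1) u
    · rw [if_pos h, if_pos ((mem_tailSet_parFin k X hX (u - 1) u z).1 h)]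
    · rw [if_neg h, if_neg (fun hh => h ((mem_tailSet_parFin k X hX (u - 1) u z).2 hh))]
  -- the summand splits into an identity part and a spreading part
  have hsplit : ∀ p : (Fin k → Ltr) × Finset (Fin k),
      diagW k X u p.1 p.2 * unifDens (parFin k X) (diagQ k X u p.1 p.2) z
        = (if isId k u p.1 p.2 ∧ w1 = p.1 then E⁻¹ else 0)
          + (if isSp k u p.1 p.2 ∧ w1 = flipSet k p.1 p.2
              then (E * ((nR k p.1).choose (nR k p.1 - nB k p.1) : ℕ))⁻¹ else 0) := by
    rintro ⟨w, J⟩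
    dsimp only
    rw [unifDens_diagQ k X u hX]
    unfold diagW
    rw [← hE]
    by_cases h1 : isId k u w J
    · have hnsp : ¬ isSp k u w J := by
        intro h2
        have h3 := h2.2.2.2
        rw [h1.1, Finset.card_empty] at h3
        have := h1.2.1.1; have := h2.2.1
        omega
      rw [if_pos h1, if_pos h1, if_neg (show ¬ (isSp k u w J ∧ w1 = flipSet k w J) from fun h => hnsp h.1),
        add_zero]
      by_cases hw : w1 = w
      · rw [if_pos (show isId k u w J ∧ w1 = w from ⟨h1, hw⟩), if_pos (show wordOf k X z = w from hw)]
        rw [hw] at hpos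
        field_simp
      · rw [if_neg (show ¬ (isId k u w J ∧ w1 = w) from fun h => hw h.2),
          if_neg (show ¬ (wordOf k X z = w) from fun h => hw h), mul_zero]
    · rw [if_neg h1, if_neg h1, if_neg (show ¬ (isId k u w J ∧ w1 = w) from fun h => h1 h.1), zero_add]
      by_cases h2 : isSp k u w J
      · rw [if_pos h2, if_pos h2]
        by_cases hw : w1 = flipSet k w J
        · rw [if_pos (show isSp k u w J ∧ w1 = flipSet k w J from ⟨h2, hw⟩),
            if_pos (show wordOf k X z = flipSet k w J from hw), card_blockOf_flipSet k X w J h2.2.2.1]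
          have hpos' : (0 : ℚ) < (blockOf k X w).card := by
            rw [← card_blockOf_flipSet k X w J h2.2.2.1, ← hw]; exact hpos
          have hC : (0 : ℚ) < ((nR k w).choose (nR k w - nB k w) : ℕ) := by
            exact_mod_cast Nat.choose_pos (Nat.sub_le _ _)
          rcases eq_or_ne E 0 with hE0 | hE0
          · rw [hE0]; simp
          · field_simp
        · rw [if_neg (show ¬ (isSp k u w J ∧ w1 = flipSet k w J) from fun h => hw h.2),
            if_neg (show ¬ (wordOf k X z = flipSet k w J) from fun h => hw h), mul_zero]
      · rw [if_neg h2, if_neg h2, if_neg (show ¬ (isSp k u w J ∧ w1 = flipSet k w J) from fun h => h2 h.1),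
          mul_zero]
  rw [Finset.sum_congr rfl (fun p _ => hsplit p), Finset.sum_add_distrib]
  -- the identity part
  have hId : ∑ p : (Fin k → Ltr) × Finset (Fin k), (if isId k u p.1 p.2 ∧ w1 = p.1 then E⁻¹ else 0)
      = if srcW k u w1 ∧ tgtW k u w1 then E⁻¹ else 0 := by
    rw [Finset.sum_eq_single (w1, ∅)]
    · by_cases h : srcW k u w1 ∧ tgtW k u w1
      · rw [if_pos ⟨⟨rfl, h.1, h.2⟩, rfl⟩, if_pos h]
      · rw [if_neg (fun hh => h ⟨hh.1.2.1, hh.1.2.2⟩), if_neg h]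
    · rintro ⟨w, J⟩ _ hp
      dsimp only
      rw [if_neg]
      rintro ⟨⟨hJ, -, -⟩, hw⟩
      apply hp
      rw [Prod.mk.injEq]
      exact ⟨hw.symm, hJ⟩
    · intro h; exact absurd (Finset.mem_univ _) h
  -- the spreading part
  have hSp : ∑ p : (Fin k → Ltr) × Finset (Fin k), (if isSp k u p.1 p.2 ∧ w1 = flipSet k p.1 p.2
      then (E * ((nR k p.1).choose (nR k p.1 - nB k p.1) : ℕ))⁻¹ else 0)
      = if nR k w1 = u - 1 ∧ u ≤ nB k w1 then E⁻¹ else 0 := by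
    rw [Fintype.sum_prod_type, Finset.sum_comm]
    -- for a fixed `J`, only `w = unflip w1 J` contributes
    have hJ : ∀ J : Finset (Fin k), ∑ w : Fin k → Ltr, (if isSp k u w J ∧ w1 = flipSet k w J
        then (E * ((nR k w).choose (nR k w - nB k w) : ℕ))⁻¹ else 0)
        = if J ∈ (blueSet k w1).powersetCard (nB k w1 - (u - 1)) ∧ nR k w1 = u - 1 ∧ u ≤ nB k w1
          then (E * ((nB k w1).choose (nB k w1 - (u - 1)) : ℕ))⁻¹ else 0 := by
      intro J
      rw [Finset.sum_eq_single (unflip k w1 J)]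
      · by_cases hc : J ∈ (blueSet k w1).powersetCard (nB k w1 - (u - 1)) ∧ nR k w1 = u - 1 ∧ u ≤ nB k w1
        · rw [if_pos hc]
          obtain ⟨hJm, hr1, hb1⟩ := hc
          rw [Finset.mem_powersetCard] at hJm
          have hnR := nR_unflip k w1 J hJm.1
          have hnB := nB_unflip k w1 J hJm.1
          have hfl := flipSet_unflip_eq k w1 J hJm.1
          have hsp : isSp k u (unflip k w1 J) J := by
            refine ⟨⟨?_, ?_⟩, ?_, unflip_sub_redSet k w1 J, ?_⟩ <;> omega
          rw [if_pos ⟨hsp, hfl.symm⟩]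
          have e1 : nR k (unflip k w1 J) = nB k w1 := by omega
          have e2 : nR k (unflip k w1 J) - nB k (unflip k w1 J) = nB k w1 - (u - 1) := by omega
          rw [e2, e1]
        · rw [if_neg hc, if_neg]
          rintro ⟨hsp, hfl⟩
          apply hc
          have hJb : J ⊆ blueSet k w1 := sub_blueSet_of_flipSet k _ w1 J hfl.symm
          have hnR := nR_unflip k w1 J hJb
          have hnB := nB_unflip k w1 J hJb
          have h1 := hsp.1.1; have h2 := hsp.2.1; have h3 := hsp.2.2.2
          refine ⟨Finset.mem_powersetCard.2 ⟨hJb, ?_⟩, ?_, ?_⟩ <;> omega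
      · intro w _ hw
        rw [if_neg]
        rintro ⟨hsp, hfl⟩
        exact hw (eq_unflip_of_flipSet k w w1 J hsp.2.2.1 hfl.symm)
      · intro h; exact absurd (Finset.mem_univ _) h
    rw [Finset.sum_congr rfl (fun J _ => hJ J)]
    by_cases hc : nR k w1 = u - 1 ∧ u ≤ nB k w1
    · rw [if_pos hc]
      have hterm : ∀ J : Finset (Fin k), (if J ∈ (blueSet k w1).powersetCard (nB k w1 - (u - 1))
          ∧ nR k w1 = u - 1 ∧ u ≤ nB k w1 then (E * ((nB k w1).choose (nB k w1 - (u - 1)) : ℕ))⁻¹ else 0)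
          = if J ∈ (blueSet k w1).powersetCard (nB k w1 - (u - 1))
            then (E * ((nB k w1).choose (nB k w1 - (u - 1)) : ℕ))⁻¹ else 0 := by
        intro J
        by_cases hJ : J ∈ (blueSet k w1).powersetCard (nB k w1 - (u - 1))
        · rw [if_pos ⟨hJ, hc⟩, if_pos hJ]
        · rw [if_neg (fun h => hJ h.1), if_neg hJ]
      rw [Finset.sum_congr rfl (fun J _ => hterm J), Finset.sum_ite_mem, Finset.univ_inter, Finset.sum_const,
        Finset.card_powersetCard, ← nB_eq_card_blueSet, nsmul_eq_mul]
      have hC : (0 : ℚ) < ((nB k w1).choose (nB k w1 - (u - 1)) : ℕ) := by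
        exact_mod_cast Nat.choose_pos (Nat.sub_le _ _)
      rcases eq_or_ne E 0 with hE0 | hE0
      · rw [hE0]; simp
      · field_simp
    · rw [if_neg hc]
      apply Finset.sum_eq_zero
      intro J _
      rw [if_neg (fun h => hc h.2)]
  rw [hId, hSp, hR]
  by_cases ht : tgtW k u w1
  · rw [if_pos ht]
    rcases (show (srcW k u w1 ∧ tgtW k u w1) ∨ (nR k w1 = u - 1 ∧ u ≤ nB k w1) by
        by_cases h : u ≤ nR k w1
        · exact Or.inl ⟨⟨h, le_trans (Nat.sub_le u 1) ht.2⟩, ht⟩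
        · exact Or.inr ⟨by have := ht.1; omega, ht.2⟩) with h | h
    · rw [if_pos h, if_neg (fun hh => by have := h.1.1; have := hh.1; omega), add_zero]
    · rw [if_neg (fun hh => by have := h.1; have := hh.1.1; omega), if_pos h, zero_add]
  · rw [if_neg ht, if_neg (fun h => ht h.2), if_neg (fun h => ht ⟨by have := h.1; omega, h.2⟩), add_zero]

/-- **(SD) at every diagonal position `(u, u−1)`, `u ≥ 1`, on the parallel composition of `k` flow-one factors,
for every `k`**: the uniform measure on `{r ≥ u, b ≥ u−1}` is stochastically dominated by the uniform measure on
`{r ≥ u−1, b ≥ u}` -/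
theorem sdomZ_parFin_diag (hX : ∀ i, FlowOne (X i)) (hu : 1 ≤ u) :
    SDomZ (parFin k X) (u : ℤ) ((u : ℤ) - 1) := by
  rw [sdomZ_iff_blockDom]
  have e1 : ((u : ℤ)).toNat = u := by omega
  have e2 : ((u : ℤ) - 1).toNat = u - 1 := by omega
  have e3 : (((u : ℤ) - 1) + 1).toNat = u := by omega
  rw [e1, e2, e3]
  exact blockDom_of_mixture (parFin k X) (fun p : (Fin k → Ltr) × Finset (Fin k) => diagP k X u p.1 p.2)
    (fun p => diagQ k X u p.1 p.2) (fun p => diagW k X u p.1 p.2) (fun p => diagW_nonneg k X u p.1 p.2)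
    (fun p => diagP_dom k X u p.1 p.2) (fun p => diagQ_nonempty k X u p.1 p.2) _ _
    (diag_src_cov k X u hX hu) (diag_tgt_cov k X u hX hu)

/-- the diagonal members in `ℕ`-form: for every monotone weight `f` and every `u ≥ 1`,
`Σ_f(u, u−1) · T(u−1, u) ≤ Σ_f(u−1, u) · T(u, u−1)` on the parallel composition of `k` flow-one factors -/
theorem sdom_parFin_diag (hX : ∀ i, FlowOne (X i)) (hu : 1 ≤ u) (f : (parFin k X).Conf → ℕ) (hf : Monotone f) :
    tailSum (parFin k X) f u (u - 1) * tailCount (parFin k X) (u - 1) u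
      ≤ tailSum (parFin k X) f (u - 1) u * tailCount (parFin k X) u (u - 1) := by
  have key := sdomZ_parFin_diag k X u hX hu f hf
  have e1 : ((u : ℤ)).toNat = u := by omega
  have e2 : ((u : ℤ) - 1).toNat = u - 1 := by omega
  have e3 : (((u : ℤ) - 1) + 1).toNat = u := by omega
  rw [e1, e2, e3] at key
  exact key

end Diag

end Summit.Ventures.PercRepro2.Tail2D
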